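import Mathlib.Topology.Baire.Lemmas
import Mathlib.Topology.Baire.CompleteMetrizable
import Literature.Geometry.Lorentzian.FinalState
import Literature.Geometry.Lorentzian.Genericity
import HarnessLib
import Literature.Geometry.Lorentzian.TameGenericityDiagonal

/-!
# Route PhotonSphereChannels · crux `TameCensorship` (stmt-FinalStateConjecture-17431) · line `Sketch`, skeleton v9 ·
# stub `stub_pathOfResidual`: a residually escapable Q at an admissible d yields a compactly supported admissible path with Q-good small members (def-free)

Helper file (`--supports stmt-FinalStateConjecture-17431`) of line `Sketch` (lead c4, 2026-08-17, wave 2): one brick of the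
RESIDUAL legend. Residual escapability of a property `Q` of initial data at a datum `d`: every compactly supported smooth
admissible probe through `d` enriches, along an injective linear map of parameter spaces, to one along all of whose further
enrichments a RESIDUAL (comeagre, `residual (EuclideanSpace ℝ (Fin p))`, Mathlib `Topology/GDelta/Basic`) set of radial
directions has `Q` for all small non-zero parameters — the v9 weakening of the open-dense ("robust") legend of v4–v8.

From residual escapability at an ADMISSIBLE `d` this file extracts a jointly smooth one-parameter family through `d`
of admissible data, agreeing with `d` off one compact set, whose small non-zero members satisfy `Q`. Proof: enrich
the constant `0`-parameter probe, take the trivial further enrichment (`L' = id`), use that a residual subset of the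
Baire space `ℝⁿ` (complete normed space, `BaireSpace.of_completelyPseudoMetrizable`) is dense
(`dense_of_mem_residual`), hence non-empty, pick a direction `v` in it and set `G c := G₁ ((c 0) • v)`; joint
smoothness by `IsSmoothDataFamily.comp_contDiff`. Verbatim analogue of the landed robust brick `stub_pathOfRobust`.

Reference: D. Christodoulou, CQG 16 (1999) A23, p. A24 (the families `α₀ + λ f`); the Baire step is folklore.
-/

set_option linter.dupNamespace false

open Literature.Geometry.Lorentzian
open scoped Manifold ContDiff Topology
open Filter Set Function

noncomputable section

namespace Summit.FinalStateConjecture.FinalStateConjecture.Theorems.PhotonSphereChannels.TameCensorshipUnwind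

/-- **Stub `stub_pathOfResidual` of line `Sketch` (skeleton v9) for the crux `PhotonSphereChannels.TameCensorship`
(stmt-FinalStateConjecture-17431): a residually escapable property yields a compactly supported admissible PATH of good
small members.** If `Q` is residually escapable at the admissible datum `d` (every compactly supported smooth
admissible probe through `d` enriches, along an injective linear map of parameter spaces, to one along all of whose
further enrichments a residual set of radial directions has `Q` for all small non-zero parameters), then there is a
jointly smooth one-parameter family `G : ℝ¹ → data` through `d`, with admissible members agreeing with `d` (both
fundamental forms, pointwise) off ONE compact set, whose members with `0 < ‖c‖ < ε` satisfy `Q`. Proof: enrich the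
constant `0`-parameter probe `fun _ ↦ d`, take the trivial further enrichment (`G₂ = G₁`, `L' = id`), note that the
residual escape set `U ⊆ ℝⁿ` is dense (`dense_of_mem_residual`, `ℝⁿ` being a Baire space) hence non-empty, pick
`v ∈ U` with its `δ`, and set `G c := G₁ ((c 0) • v)`; for `c ≠ 0` in `ℝ¹` one has `c 0 ≠ 0` and `|c 0| ≤ ‖c‖ < δ`.
No injectivity or immersion is claimed. [folklore] -/
theorem stub_pathOfResidual :
    ∀ (X : Type) [TopologicalSpace X] [ChartedSpace E3 X] [IsManifold (𝓡 3) ∞ X] [T2Space X]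
    [SecondCountableTopology X] [ConnectedSpace X] (d : InitialDataSet (𝓡 3) X) (Q : InitialDataSet (𝓡 3) X →
    Prop), d ∈ admissibleVacuumData X → (∀ (m : ℕ) (G : EuclideanSpace ℝ (Fin m) → InitialDataSet (𝓡 3) X),
    (InitialDataSet.IsSmoothDataFamily m G ∧ G 0 = d ∧ (∀ c, G c ∈ admissibleVacuumData X) ∧ ∃ K : Set X,
    IsCompact K ∧ ∀ c, ∀ x ∉ K, (G c).h.inner x = d.h.inner x ∧ (G c).k x = d.k x) → ∃ (n : ℕ) (G₁ :
    EuclideanSpace ℝ (Fin n) → InitialDataSet (𝓡 3) X) (L : EuclideanSpace ℝ (Fin m) →ₗ[ℝ] EuclideanSpace ℝ (Fin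
    n)), Function.Injective L ∧ (InitialDataSet.IsSmoothDataFamily n G₁ ∧ G₁ 0 = d ∧ (∀ c, G₁ c ∈
    admissibleVacuumData X) ∧ ∃ K : Set X, IsCompact K ∧ ∀ c, ∀ x ∉ K, (G₁ c).h.inner x = d.h.inner x ∧ (G₁ c).k
    x = d.k x) ∧ (∀ c, G₁ (L c) = G c) ∧ ∀ (p : ℕ) (G₂ : EuclideanSpace ℝ (Fin p) → InitialDataSet (𝓡 3) X) (L'
    : EuclideanSpace ℝ (Fin n) →ₗ[ℝ] EuclideanSpace ℝ (Fin p)), Function.Injective L' →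
    (InitialDataSet.IsSmoothDataFamily p G₂ ∧ G₂ 0 = d ∧ (∀ c, G₂ c ∈ admissibleVacuumData X) ∧ ∃ K : Set X,
    IsCompact K ∧ ∀ c, ∀ x ∉ K, (G₂ c).h.inner x = d.h.inner x ∧ (G₂ c).k x = d.k x) → (∀ c, G₂ (L' c) = G₁ c) →
    ∃ U : Set (EuclideanSpace ℝ (Fin p)), U ∈ residual (EuclideanSpace ℝ (Fin p)) ∧ ∀ v ∈ U, ∃ δ : ℝ, 0 < δ ∧ ∀
    t : ℝ, t ≠ 0 → |t| < δ → Q (G₂ (t • v))) → ∃ G : EuclideanSpace ℝ (Fin 1) → InitialDataSet (𝓡 3) X,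
    InitialDataSet.IsSmoothDataFamily 1 G ∧ G 0 = d ∧ (∀ c, G c ∈ admissibleVacuumData X) ∧ (∃ K : Set X,
    IsCompact K ∧ ∀ c, ∀ x ∉ K, (G c).h.inner x = d.h.inner x ∧ (G c).k x = d.k x) ∧ ∃ ε : ℝ, 0 < ε ∧ ∀ c, c ≠ 0
    → ‖c‖ < ε → Q (G c) := by
  intro X _ _ _ _ _ _ d Q hd hR
  obtain ⟨n, G₁, L, -, hT₁, -, hR₁⟩ := hR 0 (fun _ => d)
    ⟨InitialDataSet.isSmoothDataFamily_const 0 d, rfl, fun _ => hd, ∅, isCompact_empty,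
      fun _ _ _ => ⟨rfl, rfl⟩⟩
  obtain ⟨U, hUr, hU⟩ := hR₁ n G₁ LinearMap.id (fun a b h => h) hT₁ (fun c => rfl)
  obtain ⟨v, hv⟩ := (dense_of_mem_residual hUr).nonempty
  obtain ⟨δ, hδ, hgood⟩ := hU v hv
  obtain ⟨hG₁s, hG₁0, hG₁a, K, hK, hG₁K⟩ := hT₁
  have hπ : ContDiff ℝ ∞ (fun c : EuclideanSpace ℝ (Fin 1) => (c 0) • v) :=
    (EuclideanSpace.proj (𝕜 := ℝ) (ι := Fin 1) 0).contDiff.smul contDiff_const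
  refine ⟨fun c => G₁ ((c 0) • v), hG₁s.comp_contDiff hπ, ?_, fun c => hG₁a _,
    ⟨K, hK, fun c x hx => hG₁K _ x hx⟩, δ, hδ, fun c hc hcδ => ?_⟩
  · show G₁ (((0 : EuclideanSpace ℝ (Fin 1)) 0) • v) = d
    rw [PiLp.zero_apply, zero_smul]
    exact hG₁0
  · have hc0 : c 0 ≠ 0 := by
      intro h0
      apply hc
      ext i
      fin_cases i
      simpa using h0
    have hle : |c 0| ≤ ‖c‖ := by simpa [Real.norm_eq_abs] using PiLp.norm_apply_le c 0
    exact hgood (c 0) hc0 (hle.trans_lt hcδ)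

end Summit.FinalStateConjecture.FinalStateConjecture.Theorems.PhotonSphereChannels.TameCensorshipUnwind

end
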